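import Summits.ABC.ABC.Theses.IsogenyGlueCongruence
import Summits.ABC.ABC.Theorems.SharpDegreeOfPolyHeight.Negative.HypothesisFloor

/-!
# `PolyHeightOfBoundedPrimes` (stmt-ABC-16006, crux B' of route IsogenyGlueCongruence) — the
fixed-exponent slices `σ ≤ 6` of the item collapse to `¬ A`

Negative support (refuter crux-attack seat `refuter-rattack-stmt-ABC-16006-0`, 2026-08-16; the
extreme-parameter attack on the exponent). B' is `A → H` with `A = DegreePrimesPolyBounded` and `H`
the polynomial height conjecture for semistable curves with a FREE exponent `σ`. The floor of `H`
is already in the tree (`SharpDegreeOfPolyHeight.Negative.not_polyHeightAt_of_le_six`, Masser 1990: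
no `σ ≤ 6` slice of `H` holds, for any constant). Read on THIS item: with the exponent fixed at any
`σ ≤ 6` the implication `A → H_σ` is equivalent to `¬ A`, i.e. to refuting crux A. So the free
exponent of B' is essential, any proof of B' must output `σ > 6` whatever exponent `κ` crux A is
granted with, and nobody should file a fixed-exponent variant of B' at or below Szpiro's `6`
(barrier `Literature.Barriers.ABC.SzpiroEpsilonCannotBeDropped`).

* `polyHeightOfBoundedPrimes_exp_le_six_iff_not_degreePrimesPolyBounded` — `(A → H_σ) ↔ ¬ A` for
  `σ ≤ 6`;
* `exists_six_lt_of_polyHeightOfBoundedPrimes` — granted A, B' is witnessed only with `6 < σ`,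
  `0 < C`.
-/

noncomputable section

-- `Summit.<Summit>.<Problem>`: for the single-conjunct summit `ABC` the duplicate `ABC.ABC` is mandated.
set_option linter.dupNamespace false

open Summit.ABC.ABC.Theses.IsogenyGlueCongruence
open Summit.ABC.ABC.Theorems.SharpDegreeOfPolyHeight.Negative
  (not_polyHeightAt_of_le_six six_lt_of_polyHeightAt pos_of_polyHeightAt)

namespace Summit.ABC.ABC.Theorems.PolyHeightOfBoundedPrimes.Negative

/-- **For `σ ≤ 6` the fixed-exponent form of B' is `¬ A`.** The implication
`DegreePrimesPolyBounded → H_σ` (the consequent of B' with its exponent fixed at some `σ ≤ 6`,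
constant still free) holds iff crux A is false — because `H_σ` itself is false for `σ ≤ 6`
(`not_polyHeightAt_of_le_six`, Masser's semistable curves with `|Δ_min| > C·N⁶`).
[cite: Masser1990, Theorem and Lemma 1] -/
theorem polyHeightOfBoundedPrimes_exp_le_six_iff_not_degreePrimesPolyBounded {σ : ℝ} (hσ : σ ≤ 6) :
    (DegreePrimesPolyBounded → ∃ C : ℝ, ∀ (W : WeierstrassCurve ℚ) [W.IsElliptic]
      [W.IsGloballyMinimal] [NeZero (W.conductorNorm ℤ)], W.IsSemistable ℤ →
      ((max |W.Δ| (|W.c₄| ^ 3) : ℚ) : ℝ) ≤ C * (W.conductorNorm ℤ : ℝ) ^ σ) ↔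
      ¬ DegreePrimesPolyBounded :=
  ⟨fun h hA ↦ not_polyHeightAt_of_le_six hσ (h hA), fun h hA ↦ (h hA).elim⟩

/-- **Granted A, B' can only be witnessed above Szpiro's exponent.** If B' and crux A hold, the
consequent holds with some `σ > 6` and `C > 0`, and EVERY witnessing pair has `6 < σ`
(`six_lt_of_polyHeightAt`) and `0 < C` (`pos_of_polyHeightAt`): the degenerate parameter ranges
`σ ≤ 6`, `C ≤ 0` never occur, so a prover of B' may normalise to them without loss and must not aim
below them. [cite: Masser1990, Theorem and Lemma 1] -/
theorem exists_six_lt_of_polyHeightOfBoundedPrimes (hB' : PolyHeightOfBoundedPrimes)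
    (hA : DegreePrimesPolyBounded) :
    ∃ σ C : ℝ, 6 < σ ∧ 0 < C ∧
      ∀ (W : WeierstrassCurve ℚ) [W.IsElliptic] [W.IsGloballyMinimal]
        [NeZero (W.conductorNorm ℤ)], W.IsSemistable ℤ →
        ((max |W.Δ| (|W.c₄| ^ 3) : ℚ) : ℝ) ≤ C * (W.conductorNorm ℤ : ℝ) ^ σ := by
  obtain ⟨σ, C, h⟩ := hB' hA
  exact ⟨σ, C, six_lt_of_polyHeightAt (fun W _ _ _ hW ↦ h W hW),
    pos_of_polyHeightAt (fun W _ _ _ hW ↦ h W hW), fun W _ _ _ hW ↦ h W hW⟩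

end Summit.ABC.ABC.Theorems.PolyHeightOfBoundedPrimes.Negative

end
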